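import Literature.NumberTheory.Transcendental.HyperlogarithmsRegularValues
import HarnessLib

/-!
# Hyperlogarithms on `(0,1)`, VIII: logarithmic Taylor expansions and their primitives

Eighth layer of the analytic road to `GenusZeroPeriodsMZV` (Brown 2009): the one-variable calculus
of LOGARITHMIC TAYLOR EXPANSIONS at `0⁺`,
`φ(s) = Σ_{m ≤ M} Σ_{k ≤ n} c_{m,k} s^m log^k s + O(s^{M+1} (1+|log s|)^n)` for every `M`
(`Hyperlog.HasLogTaylor φ c n`), which is the shape of hyperlogarithms near ANY of their singular
points (at the base point the regular words have honest power series, layer III; at the other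
end-point, and for general alphabets, logarithms appear). Everything is PROVED; no named fact.

* closure under sums, scalars, products with Taylor functions (`HasTaylor.mul_hasLogTaylor`),
  multiplication by `s` (`HasLogTaylor.mul_self`), change of log-degree (`mono`);
* **closure under primitives** (`Hyperlog.hasLogTaylor_of_hasDerivAt`): if `φ' = h/s` on `(0,δ)`
  and `h` has a logarithmic Taylor expansion of log-degree `n`, then `φ` has one of log-degree
  `n + 1`, with the explicit coefficients `Hyperlog.primCoeff c n c₀` (`c₀` = the regularised value
  of `φ`, the only new constant; the log-polynomial primitives `Hyperlog.Pfun`/`Hyperlog.pcoef` of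
  `s^{m-1} log^k s`). The proof is elementary real analysis on `(0,δ)`: a function with bounded
  derivative has a limit (`exists_tendsto_of_deriv_bound`), and a function tending to `0` with
  derivative `O(s^M)` is `O(s^{M+1})` (`abs_le_of_deriv_bound_of_tendsto_zero`), both by monotonicity;
* the link with layer VI: `Reg_{s=0⁺} s^j φ(s) = c_{-j,0}` (`HasLogTaylor.hasRegValue_zpow_mul`).

This is the tool by which the expansions of hyperlogarithms at the end-point `1`, for general
alphabets, are obtained from the (reflected) differential equation by induction on the word
[Brown 2009, §5.2, Lemma 5.4-type statements "`F` admits an expansion `Σ f_{i,j}(z) logʲ z`"].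

## References

* F. C. S. Brown, *Multiple zeta values and periods of moduli spaces `𝔐̄_{0,n}`*, Ann. Sci. Éc.
  Norm. Supér. (4) 42 (2009), 371–489, §4.1–4.3, §5.2. doi:10.24033/asens.2099. [BrownENS2009]
-/

noncomputable section

open MeasureTheory intervalIntegral Set Filter
open scoped BigOperators Topology

namespace Literature.NumberTheory.Transcendental

namespace Hyperlog

/-! ### Two elementary real-analysis lemmas on `(0, δ)` -/

/-- A function with bounded derivative on `(0,δ)` has a limit at `0⁺`. [folklore] -/
theorem exists_tendsto_of_deriv_bound {ψ ψ' : ℝ → ℝ} {δ K : ℝ} (hδ : 0 < δ)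
    (hd : ∀ s ∈ Ioo 0 δ, HasDerivAt ψ (ψ' s) s) (hK : ∀ s ∈ Ioo 0 δ, |ψ' s| ≤ K) :
    ∃ ℓ, Tendsto ψ (𝓝[>] 0) (𝓝 ℓ) := by
  have hcont : ContinuousOn ψ (Ioo 0 δ) := fun s hs => (hd s hs).continuousAt.continuousWithinAt
  have hdiff : DifferentiableOn ℝ ψ (Ioo 0 δ) := fun s hs => (hd s hs).differentiableAt.differentiableWithinAt
  -- `ψ + K s` is monotone, `ψ - K s` is antitone on `(0, δ)`
  have hmono : MonotoneOn (fun s => ψ s + K * s) (Ioo 0 δ) := by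
    refine monotoneOn_of_deriv_nonneg (convex_Ioo 0 δ) (hcont.add (continuousOn_const.mul continuousOn_id))
      (by rw [interior_Ioo]; exact hdiff.add (differentiableOn_const _ |>.mul differentiableOn_id)) ?_
    intro s hs
    rw [interior_Ioo] at hs
    have h : HasDerivAt (fun s => ψ s + K * s) (ψ' s + K * 1) s := (hd s hs).add ((hasDerivAt_id s).const_mul K)
    rw [h.deriv]
    linarith [hK s hs, neg_abs_le (ψ' s)]
  have hanti : AntitoneOn (fun s => ψ s - K * s) (Ioo 0 δ) := by
    refine antitoneOn_of_deriv_nonpos (convex_Ioo 0 δ) (hcont.sub (continuousOn_const.mul continuousOn_id))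
      (by rw [interior_Ioo]; exact hdiff.sub (differentiableOn_const _ |>.mul differentiableOn_id)) ?_
    intro s hs
    rw [interior_Ioo] at hs
    have h : HasDerivAt (fun s => ψ s - K * s) (ψ' s - K * 1) s := (hd s hs).sub ((hasDerivAt_id s).const_mul K)
    rw [h.deriv]
    linarith [hK s hs, le_abs_self (ψ' s)]
  have hs₀ : δ / 2 ∈ Ioo 0 δ := ⟨by linarith, by linarith⟩
  have hbdd : BddBelow ((fun s => ψ s + K * s) '' Ioo 0 (δ / 2)) := by
    refine ⟨ψ (δ / 2) - K * (δ / 2), ?_⟩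
    rintro _ ⟨s, hs, rfl⟩
    have h1 := hanti ⟨hs.1, hs.2.trans hs₀.2⟩ hs₀ hs.2.le
    dsimp only at h1 ⊢
    have : 0 ≤ K := (abs_nonneg _).trans (hK _ hs₀)
    nlinarith [hs.1]
  have hmono' : MonotoneOn (fun s => ψ s + K * s) (Ioo 0 (δ / 2)) :=
    hmono.mono (Ioo_subset_Ioo_right (by linarith))
  have ht := hmono'.tendsto_nhdsWithin_Ioo_right (by exact nonempty_Ioo.2 (by linarith)) hbdd
  refine ⟨sInf ((fun s => ψ s + K * s) '' Ioo 0 (δ / 2)) - K * 0, ?_⟩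
  have hK0 : Tendsto (fun s : ℝ => K * s) (𝓝[>] 0) (𝓝 (K * 0)) :=
    ((continuous_const.mul continuous_id).tendsto 0).mono_left nhdsWithin_le_nhds
  have := ht.sub hK0
  simpa using this

/-- A function on `(0,δ)` which tends to `0` at `0⁺` and whose derivative is `O(s^M)` is
`O(s^{M+1})`. [folklore] -/
theorem abs_le_of_deriv_bound_of_tendsto_zero {R R' : ℝ → ℝ} {δ A : ℝ} {M : ℕ}
    (hd : ∀ s ∈ Ioo 0 δ, HasDerivAt R (R' s) s) (hA : ∀ s ∈ Ioo 0 δ, |R' s| ≤ A * s ^ M)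
    (h0 : Tendsto R (𝓝[>] 0) (𝓝 0)) : ∀ s ∈ Ioo 0 δ, |R s| ≤ A * s ^ (M + 1) / (M + 1) := by
  have hcont : ContinuousOn R (Ioo 0 δ) := fun s hs => (hd s hs).continuousAt.continuousWithinAt
  have hdiff : DifferentiableOn ℝ R (Ioo 0 δ) := fun s hs => (hd s hs).differentiableAt.differentiableWithinAt
  set B : ℝ → ℝ := fun s => A * s ^ (M + 1) / (M + 1) with hB
  have hBd : ∀ s, HasDerivAt B (A * s ^ M) s := by
    intro s
    have h := ((hasDerivAt_pow (M + 1) s).const_mul A).div_const ((M : ℝ) + 1)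
    refine h.congr_deriv ?_
    rw [Nat.add_sub_cancel]; push_cast; field_simp
  have hBc : Continuous B := by
    rw [hB]; fun_prop
  have hB0 : Tendsto B (𝓝[>] 0) (𝓝 0) := by
    have := (hBc.tendsto 0).mono_left (nhdsWithin_le_nhds (s := Ioi (0 : ℝ)))
    simpa [hB] using this
  -- `R - B` antitone, `R + B` monotone
  have hBdiff : DifferentiableOn ℝ B (Ioo 0 δ) := fun s _ => (hBd s).differentiableAt.differentiableWithinAt
  have hanti : AntitoneOn (fun s => R s - B s) (Ioo 0 δ) := by
    refine antitoneOn_of_deriv_nonpos (convex_Ioo 0 δ) (hcont.sub hBc.continuousOn)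
      (by rw [interior_Ioo]; exact hdiff.sub hBdiff) ?_
    intro s hs
    rw [interior_Ioo] at hs
    have h : HasDerivAt (fun s => R s - B s) (R' s - A * s ^ M) s := (hd s hs).sub (hBd s)
    rw [h.deriv]
    linarith [hA s hs, le_abs_self (R' s)]
  have hmono : MonotoneOn (fun s => R s + B s) (Ioo 0 δ) := by
    refine monotoneOn_of_deriv_nonneg (convex_Ioo 0 δ) (hcont.add hBc.continuousOn)
      (by rw [interior_Ioo]; exact hdiff.add hBdiff) ?_
    intro s hs
    rw [interior_Ioo] at hs
    have h : HasDerivAt (fun s => R s + B s) (R' s + A * s ^ M) s := (hd s hs).add (hBd s)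
    rw [h.deriv]
    linarith [hA s hs, neg_abs_le (R' s)]
  intro s hs
  -- let `u → 0⁺` in `R s - B s ≤ R u - B u` and `R u + B u ≤ R s + B s`
  have h1 : R s - B s ≤ 0 := by
    have ht : Tendsto (fun u => R u - B u) (𝓝[>] 0) (𝓝 (0 - 0)) := h0.sub hB0
    rw [sub_zero] at ht
    refine ge_of_tendsto ht ?_
    filter_upwards [Ioo_mem_nhdsGT hs.1] with u hu
    exact hanti ⟨hu.1, hu.2.trans hs.2⟩ hs hu.2.le
  have h2 : 0 ≤ R s + B s := by
    have ht : Tendsto (fun u => R u + B u) (𝓝[>] 0) (𝓝 (0 + 0)) := h0.add hB0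
    rw [add_zero] at ht
    refine le_of_tendsto ht ?_
    filter_upwards [Ioo_mem_nhdsGT hs.1] with u hu
    exact hmono ⟨hu.1, hu.2.trans hs.2⟩ hs hu.2.le
  rw [abs_le]
  constructor <;> [linarith; linarith]

/-! ### Logarithmic Taylor expansions at `0⁺` -/

section LogTaylor

/-- The partial sums `T_M(s) = Σ_{m ≤ M} Σ_{k ≤ n} c_{m,k} s^m log^k s`. [folklore] -/
def logTaylorSum (c : ℕ → ℕ → ℝ) (n M : ℕ) (s : ℝ) : ℝ :=
  ∑ m ∈ Finset.range (M + 1), ∑ k ∈ Finset.range (n + 1), c m k * (s ^ m * Real.log s ^ k)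

/-- **Logarithmic Taylor expansion to every order at `0⁺`** with log-degree `≤ n`:
`φ(s) = Σ_{m ≤ M, k ≤ n} c_{m,k} s^m log^k s + O(s^{M+1} (1 + |log s|)^n)` for every `M`. [folklore] -/
def HasLogTaylor (φ : ℝ → ℝ) (c : ℕ → ℕ → ℝ) (n : ℕ) : Prop :=
  (∀ m k, n < k → c m k = 0) ∧
    ∀ M : ℕ, ∃ C : ℝ, ∀ᶠ s in 𝓝[>] (0 : ℝ),
      |φ s - logTaylorSum c n M s| ≤ C * (s ^ (M + 1) * (1 + |Real.log s|) ^ n)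

/-- `1 ≤ 1 + |log s|`. [folklore] -/
theorem one_le_lam (s : ℝ) : 1 ≤ 1 + |Real.log s| := le_add_of_nonneg_right (abs_nonneg _)

/-- `|s^m log^k s| ≤ (1 + |log s|)^n` on `(0,1)` for `k ≤ n`. [folklore] -/
theorem abs_pow_mul_log_pow_le {s : ℝ} (hs : s ∈ Ioo (0 : ℝ) 1) (m : ℕ) {k n : ℕ} (hk : k ≤ n) :
    |s ^ m * Real.log s ^ k| ≤ (1 + |Real.log s|) ^ n := by
  rw [abs_mul, abs_pow, abs_pow, abs_of_pos hs.1]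
  calc s ^ m * |Real.log s| ^ k ≤ 1 * (1 + |Real.log s|) ^ k :=
        mul_le_mul (pow_le_one₀ hs.1.le hs.2.le) (pow_le_pow_left₀ (abs_nonneg _) (by linarith [abs_nonneg (Real.log s)]) _)
          (pow_nonneg (abs_nonneg _) _) zero_le_one
    _ ≤ (1 + |Real.log s|) ^ n := by rw [one_mul]; exact pow_le_pow_right₀ (one_le_lam s) hk

/-- The partial sums are `O((1+|log s|)^n)` on `(0,1)`. [folklore] -/
theorem abs_logTaylorSum_le (c : ℕ → ℕ → ℝ) (n M : ℕ) {s : ℝ} (hs : s ∈ Ioo (0 : ℝ) 1) :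
    |logTaylorSum c n M s| ≤
      (∑ m ∈ Finset.range (M + 1), ∑ k ∈ Finset.range (n + 1), |c m k|) * (1 + |Real.log s|) ^ n := by
  unfold logTaylorSum
  rw [Finset.sum_mul]
  refine (Finset.abs_sum_le_sum_abs _ _).trans (Finset.sum_le_sum fun m _ => ?_)
  rw [Finset.sum_mul]
  refine (Finset.abs_sum_le_sum_abs _ _).trans (Finset.sum_le_sum fun k hk => ?_)
  rw [abs_mul]
  exact mul_le_mul_of_nonneg_left (abs_pow_mul_log_pow_le hs m (Nat.lt_succ_iff.mp (Finset.mem_range.mp hk)))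
    (abs_nonneg _)

/-- A function with a logarithmic Taylor expansion is `O((1+|log s|)^n)` at `0⁺`. [folklore] -/
theorem HasLogTaylor.bound {φ : ℝ → ℝ} {c : ℕ → ℕ → ℝ} {n : ℕ} (h : HasLogTaylor φ c n) :
    ∃ B : ℝ, ∀ᶠ s in 𝓝[>] (0 : ℝ), |φ s| ≤ B * (1 + |Real.log s|) ^ n := by
  obtain ⟨C, hC⟩ := h.2 0
  refine ⟨(∑ m ∈ Finset.range 1, ∑ k ∈ Finset.range (n + 1), |c m k|) + |C|, ?_⟩
  filter_upwards [hC, Ioo_mem_nhdsGT (zero_lt_one' ℝ)] with s h1 hs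
  have h2 := abs_logTaylorSum_le c n 0 hs
  have hΛ : 0 ≤ (1 + |Real.log s|) ^ n := pow_nonneg (by linarith [abs_nonneg (Real.log s)]) _
  have h3 : |φ s - logTaylorSum c n 0 s| ≤ |C| * (1 + |Real.log s|) ^ n := by
    refine h1.trans ?_
    rw [zero_add, pow_one]
    calc C * (s * (1 + |Real.log s|) ^ n) ≤ |C| * (s * (1 + |Real.log s|) ^ n) :=
          mul_le_mul_of_nonneg_right (le_abs_self C) (mul_nonneg hs.1.le hΛ)
      _ ≤ |C| * (1 * (1 + |Real.log s|) ^ n) :=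
          mul_le_mul_of_nonneg_left (mul_le_mul_of_nonneg_right hs.2.le hΛ) (abs_nonneg C)
      _ = |C| * (1 + |Real.log s|) ^ n := by rw [one_mul]
  calc |φ s| = |logTaylorSum c n 0 s + (φ s - logTaylorSum c n 0 s)| := by ring_nf
    _ ≤ |logTaylorSum c n 0 s| + |φ s - logTaylorSum c n 0 s| := abs_add_le _ _
    _ ≤ _ := by rw [add_mul]; exact add_le_add h2 h3

/-- Eventual modification does not change the expansion. [folklore] -/
theorem HasLogTaylor.congr {φ ψ : ℝ → ℝ} {c : ℕ → ℕ → ℝ} {n : ℕ} (h : HasLogTaylor φ c n)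
    (heq : ∀ᶠ s in 𝓝[>] (0 : ℝ), φ s = ψ s) : HasLogTaylor ψ c n := by
  refine ⟨h.1, fun M => ?_⟩
  obtain ⟨C, hC⟩ := h.2 M
  exact ⟨C, by filter_upwards [hC, heq] with s h1 h2; rwa [← h2]⟩

/-- Changing the coefficients to equal ones. [folklore] -/
theorem HasLogTaylor.congr_coeff {φ : ℝ → ℝ} {c c' : ℕ → ℕ → ℝ} {n : ℕ} (h : HasLogTaylor φ c n)
    (heq : ∀ m k, c m k = c' m k) : HasLogTaylor φ c' n := by
  have : c = c' := funext fun m => funext fun k => heq m k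
  subst this; exact h

/-- Raising the log-degree bound. [folklore] -/
theorem HasLogTaylor.mono {φ : ℝ → ℝ} {c : ℕ → ℕ → ℝ} {n n' : ℕ} (h : HasLogTaylor φ c n) (hn : n ≤ n') :
    HasLogTaylor φ c n' := by
  refine ⟨fun m k hk => h.1 m k (lt_of_le_of_lt hn hk), fun M => ?_⟩
  obtain ⟨C, hC⟩ := h.2 M
  refine ⟨|C|, ?_⟩
  filter_upwards [hC, Ioo_mem_nhdsGT (zero_lt_one' ℝ)] with s h1 hs
  have hsum : logTaylorSum c n' M s = logTaylorSum c n M s := by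
    unfold logTaylorSum
    refine Finset.sum_congr rfl fun m _ => ?_
    rw [← Finset.sum_range_add_sum_Ico _ (Nat.succ_le_succ hn), add_eq_left]
    refine Finset.sum_eq_zero fun k hk => ?_
    rw [Finset.mem_Ico] at hk
    rw [h.1 m k (by omega), zero_mul]
  rw [hsum]
  refine h1.trans ?_
  have hΛ1 := one_le_lam s
  calc C * (s ^ (M + 1) * (1 + |Real.log s|) ^ n) ≤ |C| * (s ^ (M + 1) * (1 + |Real.log s|) ^ n) :=
        mul_le_mul_of_nonneg_right (le_abs_self C)
          (mul_nonneg (pow_nonneg hs.1.le _) (pow_nonneg (zero_le_one.trans hΛ1) _))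
    _ ≤ |C| * (s ^ (M + 1) * (1 + |Real.log s|) ^ n') :=
        mul_le_mul_of_nonneg_left (mul_le_mul_of_nonneg_left (pow_le_pow_right₀ hΛ1 hn)
          (pow_nonneg hs.1.le _)) (abs_nonneg C)

/-- Sums. [folklore] -/
theorem HasLogTaylor.add {φ ψ : ℝ → ℝ} {c d : ℕ → ℕ → ℝ} {n : ℕ} (hφ : HasLogTaylor φ c n)
    (hψ : HasLogTaylor ψ d n) : HasLogTaylor (fun s => φ s + ψ s) (fun m k => c m k + d m k) n := by
  refine ⟨fun m k hk => by show c m k + d m k = 0; rw [hφ.1 m k hk, hψ.1 m k hk, add_zero], fun M => ?_⟩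
  obtain ⟨C, hC⟩ := hφ.2 M
  obtain ⟨D, hD⟩ := hψ.2 M
  refine ⟨C + D, ?_⟩
  filter_upwards [hC, hD] with s h1 h2
  have hsum : logTaylorSum (fun m k => c m k + d m k) n M s = logTaylorSum c n M s + logTaylorSum d n M s := by
    unfold logTaylorSum
    rw [← Finset.sum_add_distrib]
    refine Finset.sum_congr rfl fun m _ => ?_
    rw [← Finset.sum_add_distrib]
    refine Finset.sum_congr rfl fun k _ => ?_
    ring
  rw [hsum, add_mul]
  calc |φ s + ψ s - (logTaylorSum c n M s + logTaylorSum d n M s)|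
      = |(φ s - logTaylorSum c n M s) + (ψ s - logTaylorSum d n M s)| := by ring_nf
    _ ≤ _ := (abs_add_le _ _).trans (add_le_add h1 h2)

/-- Scalar multiples. [folklore] -/
theorem HasLogTaylor.smul {φ : ℝ → ℝ} {c : ℕ → ℕ → ℝ} {n : ℕ} (hφ : HasLogTaylor φ c n) (r : ℝ) :
    HasLogTaylor (fun s => r * φ s) (fun m k => r * c m k) n := by
  refine ⟨fun m k hk => by show r * c m k = 0; rw [hφ.1 m k hk, mul_zero], fun M => ?_⟩
  obtain ⟨C, hC⟩ := hφ.2 M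
  refine ⟨|r| * C, ?_⟩
  filter_upwards [hC] with s h1
  have hsum : logTaylorSum (fun m k => r * c m k) n M s = r * logTaylorSum c n M s := by
    unfold logTaylorSum
    rw [Finset.mul_sum]
    refine Finset.sum_congr rfl fun m _ => ?_
    rw [Finset.mul_sum]
    refine Finset.sum_congr rfl fun k _ => ?_
    ring
  rw [hsum, ← mul_sub, abs_mul, mul_assoc]
  exact mul_le_mul_of_nonneg_left h1 (abs_nonneg r)

/-- The zero function. [folklore] -/
theorem hasLogTaylor_zero (n : ℕ) : HasLogTaylor (fun _ => 0) (fun _ _ => 0) n := by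
  refine ⟨fun _ _ _ => rfl, fun M => ⟨0, Eventually.of_forall fun s => ?_⟩⟩
  simp [logTaylorSum]

/-- Finite sums. [folklore] -/
theorem HasLogTaylor.sum {ι : Type*} (S : Finset ι) {φ : ι → ℝ → ℝ} {c : ι → ℕ → ℕ → ℝ} {n : ℕ}
    (h : ∀ i ∈ S, HasLogTaylor (φ i) (c i) n) :
    HasLogTaylor (fun s => ∑ i ∈ S, φ i s) (fun m k => ∑ i ∈ S, c i m k) n := by
  classical
  induction S using Finset.induction_on with
  | empty => simpa using hasLogTaylor_zero n
  | insert i S hi IH =>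
    have h1 := (h i (Finset.mem_insert_self i S)).add (IH fun j hj => h j (Finset.mem_insert_of_mem hj))
    simp only [Finset.sum_insert hi]
    exact h1

/-- A Taylor expansion is a logarithmic Taylor expansion of log-degree `0`. [folklore] -/
theorem HasTaylor.hasLogTaylor {ρ : ℝ → ℝ} {ψ : ℕ → ℝ} (h : HasTaylor ρ ψ) :
    HasLogTaylor ρ (fun m k => if k = 0 then ψ m else 0) 0 := by
  refine ⟨fun m k hk => if_neg (by omega), fun M => ?_⟩
  obtain ⟨C, hC⟩ := h M
  refine ⟨C, ?_⟩
  filter_upwards [hC] with s h1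
  have hsum : logTaylorSum (fun m k => if k = 0 then ψ m else 0) 0 M s = ∑ i ∈ Finset.range (M + 1), ψ i * s ^ i := by
    unfold logTaylorSum
    refine Finset.sum_congr rfl fun m _ => ?_
    simp
  rw [hsum, pow_zero, mul_one]
  exact h1

open Finset in
/-- **Product of a Taylor expansion with a logarithmic Taylor expansion.** [folklore] -/
theorem HasTaylor.mul_hasLogTaylor {ρ φ : ℝ → ℝ} {ψ : ℕ → ℝ} {c : ℕ → ℕ → ℝ} {n : ℕ}
    (hρ : HasTaylor ρ ψ) (hφ : HasLogTaylor φ c n) :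
    HasLogTaylor (fun s => ρ s * φ s) (fun m k => ∑ ij ∈ antidiagonal m, ψ ij.1 * c ij.2 k) n := by
  refine ⟨fun m k hk => Finset.sum_eq_zero fun ij _ => by rw [hφ.1 _ k hk, mul_zero], fun M => ?_⟩
  obtain ⟨C₁, hC₁⟩ := hρ M
  obtain ⟨C₂, hC₂⟩ := hφ.2 M
  obtain ⟨Bφ, hBφ⟩ := hφ.bound
  set P : ℝ → ℝ := fun s => ∑ i ∈ range (M + 1), ψ i * s ^ i with hP
  set B₁ : ℝ := ∑ i ∈ range (M + 1), |ψ i| with hB₁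
  set B₂ : ℝ := ∑ m ∈ range (M + 1), ∑ k ∈ range (n + 1), |c m k| with hB₂
  have hB₁0 : 0 ≤ B₁ := Finset.sum_nonneg fun _ _ => abs_nonneg _
  refine ⟨|C₁| * |Bφ| + B₁ * |C₂| + B₁ * B₂, ?_⟩
  filter_upwards [hC₁, hC₂, hBφ, Ioo_mem_nhdsGT (zero_lt_one' ℝ)] with s h1 h2 h3 hs
  set Λ : ℝ := 1 + |Real.log s| with hΛ
  have hΛ1 : 1 ≤ Λ := one_le_lam s
  have hΛ0 : 0 ≤ Λ ^ n := by positivity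
  have hs0 := hs.1.le
  have hsM : s ^ (M + 1) ≤ 1 := pow_le_one₀ hs0 hs.2.le
  have hP₁b : |P s| ≤ B₁ := by
    refine (Finset.abs_sum_le_sum_abs _ _).trans (Finset.sum_le_sum fun i _ => ?_)
    rw [abs_mul, abs_pow, abs_of_pos hs.1]
    exact mul_le_of_le_one_right (abs_nonneg _) (pow_le_one₀ hs0 hs.2.le)
  -- split the product of truncations at order `M` (inner log-sums ride along as `g`)
  set g : ℕ → ℝ := fun m => ∑ k ∈ range (n + 1), c m k * Real.log s ^ k with hg
  have hT : logTaylorSum c n M s = ∑ m ∈ range (M + 1), g m * s ^ m := by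
    unfold logTaylorSum
    refine Finset.sum_congr rfl fun m _ => ?_
    rw [hg, Finset.sum_mul]
    refine Finset.sum_congr rfl fun k _ => ?_
    ring
  set H : ℝ := ∑ jk ∈ (range (M + 1) ×ˢ range (M + 1)).filter (fun jk => ¬ jk.1 + jk.2 ≤ M),
    ψ jk.1 * g jk.2 * s ^ (jk.1 + jk.2) with hH
  have hprod : P s * logTaylorSum c n M s =
      ∑ i ∈ range (M + 1), (∑ jk ∈ antidiagonal i, ψ jk.1 * g jk.2) * s ^ i + H := by
    rw [hT, hP, Finset.sum_mul_sum, ← Finset.sum_product', ← sum_filter_le_eq_sum_antidiagonal, hH,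
      Finset.sum_filter_add_sum_filter_not]
    refine Finset.sum_congr rfl fun jk _ => ?_
    rw [pow_add]; ring
  have hlow : ∑ i ∈ range (M + 1), (∑ jk ∈ antidiagonal i, ψ jk.1 * g jk.2) * s ^ i =
      logTaylorSum (fun m k => ∑ ij ∈ antidiagonal m, ψ ij.1 * c ij.2 k) n M s := by
    unfold logTaylorSum
    refine Finset.sum_congr rfl fun i _ => ?_
    rw [hg]
    simp only [Finset.mul_sum, Finset.sum_mul]
    rw [Finset.sum_comm]
    refine Finset.sum_congr rfl fun k _ => Finset.sum_congr rfl fun jk _ => ?_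
    ring
  have hgb : ∀ m ∈ range (M + 1), |g m| ≤ (∑ k ∈ range (n + 1), |c m k|) * Λ ^ n := by
    intro m _
    rw [hg, Finset.sum_mul]
    refine (Finset.abs_sum_le_sum_abs _ _).trans (Finset.sum_le_sum fun k hk => ?_)
    rw [abs_mul]
    refine mul_le_mul_of_nonneg_left ?_ (abs_nonneg _)
    have := abs_pow_mul_log_pow_le hs 0 (Nat.lt_succ_iff.mp (Finset.mem_range.mp hk)) (n := n)
    rwa [pow_zero, one_mul] at this
  have hhigh : |H| ≤ B₁ * B₂ * (s ^ (M + 1) * Λ ^ n) := by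
    rw [hH]
    refine (Finset.abs_sum_le_sum_abs _ _).trans ?_
    have hle : ∀ jk ∈ (range (M + 1) ×ˢ range (M + 1)).filter (fun jk => ¬ jk.1 + jk.2 ≤ M),
        |ψ jk.1 * g jk.2 * s ^ (jk.1 + jk.2)| ≤
          |ψ jk.1| * ((∑ k ∈ range (n + 1), |c jk.2 k|) * Λ ^ n) * s ^ (M + 1) := by
      intro jk hjk
      rw [Finset.mem_filter, Finset.mem_product] at hjk
      rw [abs_mul, abs_mul, abs_pow, abs_of_pos hs.1]
      refine mul_le_mul (mul_le_mul_of_nonneg_left (hgb jk.2 hjk.1.2) (abs_nonneg _))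
        (pow_le_pow_of_le_one hs0 hs.2.le (by omega)) (pow_nonneg hs0 _) (by positivity)
    refine (Finset.sum_le_sum hle).trans ?_
    rw [← Finset.sum_mul]
    have hre : ∑ jk ∈ (range (M + 1) ×ˢ range (M + 1)).filter (fun jk => ¬ jk.1 + jk.2 ≤ M),
        |ψ jk.1| * ((∑ k ∈ range (n + 1), |c jk.2 k|) * Λ ^ n) ≤ B₁ * B₂ * Λ ^ n := by
      refine (Finset.sum_le_sum_of_subset_of_nonneg (Finset.filter_subset _ _) fun _ _ _ => by positivity).trans ?_
      rw [Finset.sum_product, hB₁, hB₂, Finset.sum_mul, Finset.sum_mul]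
      refine le_of_eq (Finset.sum_congr rfl fun i _ => ?_)
      rw [Finset.mul_sum, Finset.sum_mul]
      refine Finset.sum_congr rfl fun m _ => ?_
      ring
    calc _ ≤ B₁ * B₂ * Λ ^ n * s ^ (M + 1) := mul_le_mul_of_nonneg_right hre (pow_nonneg hs0 _)
      _ = B₁ * B₂ * (s ^ (M + 1) * Λ ^ n) := by ring
  have hdecomp : ρ s * φ s - logTaylorSum (fun m k => ∑ ij ∈ antidiagonal m, ψ ij.1 * c ij.2 k) n M s
      = (ρ s - P s) * φ s + P s * (φ s - logTaylorSum c n M s) + H := by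
    rw [← hlow]; linear_combination hprod
  rw [hdecomp]
  calc |(ρ s - P s) * φ s + P s * (φ s - logTaylorSum c n M s) + H|
      ≤ |(ρ s - P s) * φ s| + |P s * (φ s - logTaylorSum c n M s)| + |H| :=
        (abs_add_le _ _).trans (add_le_add (abs_add_le _ _) le_rfl)
    _ ≤ |C₁| * s ^ (M + 1) * (|Bφ| * Λ ^ n) + B₁ * (|C₂| * (s ^ (M + 1) * Λ ^ n)) + B₁ * B₂ * (s ^ (M + 1) * Λ ^ n) := by
        refine add_le_add (add_le_add ?_ ?_) hhigh
        · rw [abs_mul]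
          refine mul_le_mul (h1.trans (mul_le_mul_of_nonneg_right (le_abs_self _) (pow_nonneg hs0 _)))
            (h3.trans (mul_le_mul_of_nonneg_right (le_abs_self _) hΛ0)) (abs_nonneg _) (by positivity)
        · rw [abs_mul]
          exact mul_le_mul hP₁b (h2.trans (mul_le_mul_of_nonneg_right (le_abs_self _) (by positivity)))
            (abs_nonneg _) hB₁0
    _ = (|C₁| * |Bφ| + B₁ * |C₂| + B₁ * B₂) * (s ^ (M + 1) * Λ ^ n) := by ring

/-- Multiplication by `s` shifts the expansion. [folklore] -/
theorem HasLogTaylor.mul_self {φ : ℝ → ℝ} {c : ℕ → ℕ → ℝ} {n : ℕ} (hφ : HasLogTaylor φ c n) :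
    HasLogTaylor (fun s => s * φ s) (fun m k => if m = 0 then 0 else c (m - 1) k) n := by
  refine ⟨fun m k hk => by show (if m = 0 then 0 else c (m - 1) k) = 0; split_ifs <;> simp [hφ.1 _ k hk], fun M => ?_⟩
  cases M with
  | zero =>
    obtain ⟨B, hB⟩ := hφ.bound
    refine ⟨B, ?_⟩
    filter_upwards [hB, self_mem_nhdsWithin] with s h1 hs
    have hs0 : 0 < s := hs
    have hsum : logTaylorSum (fun m k => if m = 0 then 0 else c (m - 1) k) n 0 s = 0 := by
      simp [logTaylorSum]
    rw [hsum, sub_zero, abs_mul, abs_of_pos hs0, zero_add, pow_one, ← mul_assoc, mul_comm B s, mul_assoc]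
    exact mul_le_mul_of_nonneg_left h1 hs0.le
  | succ M =>
    obtain ⟨C, hC⟩ := hφ.2 M
    refine ⟨C, ?_⟩
    filter_upwards [hC, self_mem_nhdsWithin] with s h1 hs
    have hs0 : 0 < s := hs
    have hsum : logTaylorSum (fun m k => if m = 0 then 0 else c (m - 1) k) n (M + 1) s = s * logTaylorSum c n M s := by
      unfold logTaylorSum
      rw [Finset.sum_range_succ', Finset.mul_sum]
      simp only [if_true, zero_mul, Finset.sum_const_zero, add_zero, Nat.succ_ne_zero, if_false,
        Nat.add_sub_cancel]
      refine Finset.sum_congr rfl fun m _ => ?_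
      rw [Finset.mul_sum]
      refine Finset.sum_congr rfl fun k _ => ?_
      rw [pow_succ]; ring
    rw [hsum, ← mul_sub, abs_mul, abs_of_pos hs0, pow_succ' s (M + 1)]
    calc s * |φ s - logTaylorSum c n M s| ≤ s * (C * (s ^ (M + 1) * (1 + |Real.log s|) ^ n)) :=
          mul_le_mul_of_nonneg_left h1 hs0.le
      _ = C * (s * s ^ (M + 1) * (1 + |Real.log s|) ^ n) := by ring

end LogTaylor

/-! ### Closure of logarithmic Taylor expansions under primitives -/

section Primitive

open Finset

/-- The log-polynomials `P_{m,k}` with `d/ds (s^m P_{m,k}(s)) = s^{m-1} log^k s` (`m ≥ 1`), by the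
integration-by-parts recursion `P_{m,k+1} = log^{k+1}/m - ((k+1)/m) P_{m,k}`. [folklore] -/
def Pfun (m : ℕ) : ℕ → ℝ → ℝ
  | 0, _ => (1 : ℝ) / m
  | k + 1, s => Real.log s ^ (k + 1) / m - ((k + 1 : ℝ) / m) * Pfun m k s

/-- The coefficients of `P_{m,k}`: `P_{m,k}(s) = Σ_j pcoef m k j log^j s`. [folklore] -/
def pcoef (m : ℕ) : ℕ → ℕ → ℝ
  | 0, j => if j = 0 then (1 : ℝ) / m else 0
  | k + 1, j => (if j = k + 1 then (1 : ℝ) / m else 0) - ((k + 1 : ℝ) / m) * pcoef m k j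

/-- `pcoef m k j = 0` for `j > k`. [folklore] -/
theorem pcoef_eq_zero (m : ℕ) : ∀ {k j : ℕ}, k < j → pcoef m k j = 0
  | 0, j, h => by simp [pcoef, Nat.ne_of_gt h]
  | k + 1, j, h => by
    rw [pcoef, if_neg (by omega), pcoef_eq_zero m (by omega : k < j)]; ring

/-- `P_{m,k}` is the log-polynomial with coefficients `pcoef`. [folklore] -/
theorem pfun_eq_sum (m : ℕ) : ∀ (k : ℕ) {K : ℕ}, k < K → ∀ s : ℝ,
    Pfun m k s = ∑ j ∈ range K, pcoef m k j * Real.log s ^ j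
  | 0, K, hK, s => by
    rw [Finset.sum_eq_single_of_mem 0 (Finset.mem_range.2 (by omega)) (fun j _ hj => by simp [pcoef, hj])]
    simp [Pfun, pcoef]
  | k + 1, K, hK, s => by
    have h1 : Real.log s ^ (k + 1) / m = ∑ j ∈ range K, (if j = k + 1 then 1 / (m : ℝ) else 0) * Real.log s ^ j := by
      rw [Finset.sum_eq_single_of_mem (k + 1) (Finset.mem_range.2 hK) (fun j _ hj => by rw [if_neg hj, zero_mul])]
      rw [if_pos rfl]; ring
    rw [Pfun, pfun_eq_sum m k (by omega : k < K) s, Finset.mul_sum, h1, ← Finset.sum_sub_distrib]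
    refine Finset.sum_congr rfl fun j _ => ?_
    rw [pcoef]; ring

/-- `|P_{m,k}(s)| ≤ (Σ_j |pcoef m k j|) (1 + |log s|)^n` for `k ≤ n`. [folklore] -/
theorem abs_pfun_le (m : ℕ) {k n : ℕ} (hk : k ≤ n) (s : ℝ) :
    |Pfun m k s| ≤ (∑ j ∈ range (k + 1), |pcoef m k j|) * (1 + |Real.log s|) ^ n := by
  rw [pfun_eq_sum m k (Nat.lt_succ_self k) s, Finset.sum_mul]
  refine (Finset.abs_sum_le_sum_abs _ _).trans (Finset.sum_le_sum fun j hj => ?_)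
  rw [abs_mul, abs_pow]
  refine mul_le_mul_of_nonneg_left ?_ (abs_nonneg _)
  calc |Real.log s| ^ j ≤ (1 + |Real.log s|) ^ j :=
        pow_le_pow_left₀ (abs_nonneg _) (by linarith [abs_nonneg (Real.log s)]) _
    _ ≤ (1 + |Real.log s|) ^ n := pow_le_pow_right₀ (one_le_lam s) ((Nat.lt_succ_iff.mp (mem_range.mp hj)).trans hk)

/-- `d/ds (s^m P_{m,k}(s)) = s^{m-1} log^k s` for `m ≥ 1`, `s > 0`. [folklore] -/
theorem hasDerivAt_pow_mul_pfun {m : ℕ} (hm : 1 ≤ m) : ∀ (k : ℕ) {s : ℝ}, 0 < s →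
    HasDerivAt (fun s => s ^ m * Pfun m k s) (s ^ (m - 1) * Real.log s ^ k) s
  | 0, s, hs => by
    have hm0 : (m : ℝ) ≠ 0 := by exact_mod_cast (by omega : m ≠ 0)
    have h := (hasDerivAt_pow m s).mul_const (1 / (m : ℝ))
    refine (h.congr_of_eventuallyEq (Eventually.of_forall fun x => rfl)).congr_deriv ?_
    rw [pow_zero, mul_one]; field_simp
  | k + 1, s, hs => by
    have hm0 : (m : ℝ) ≠ 0 := by exact_mod_cast (by omega : m ≠ 0)
    have IH := hasDerivAt_pow_mul_pfun hm k hs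
    have hlog : HasDerivAt (fun x => Real.log x ^ (k + 1)) (((k + 1 : ℕ) : ℝ) * Real.log s ^ k * s⁻¹) s := by
      have h := (hasDerivAt_pow (k + 1) (Real.log s)).comp s (Real.hasDerivAt_log hs.ne')
      refine h.congr_deriv ?_
      rw [Nat.add_sub_cancel]
    have h1 : HasDerivAt (fun x => x ^ m * (Real.log x ^ (k + 1) / m))
        (((m : ℕ) : ℝ) * s ^ (m - 1) * (Real.log s ^ (k + 1) / m) +
          s ^ m * (((k + 1 : ℕ) : ℝ) * Real.log s ^ k * s⁻¹ / m)) s :=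
      (hasDerivAt_pow m s).mul (hlog.div_const _)
    have h2 : HasDerivAt (fun x => x ^ m * Pfun m (k + 1) x)
        ((((m : ℕ) : ℝ) * s ^ (m - 1) * (Real.log s ^ (k + 1) / m) +
          s ^ m * (((k + 1 : ℕ) : ℝ) * Real.log s ^ k * s⁻¹ / m)) - ((k + 1) / m) * (s ^ (m - 1) * Real.log s ^ k)) s := by
      have h := h1.sub (IH.const_mul ((k + 1) / (m : ℝ)))
      refine h.congr_of_eventuallyEq (Eventually.of_forall fun x => ?_)
      show x ^ m * Pfun m (k + 1) x = x ^ m * (Real.log x ^ (k + 1) / m) - (k + 1) / m * (x ^ m * Pfun m k x)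
      rw [Pfun]; ring
    refine h2.congr_deriv ?_
    have hsm : s ^ m = s ^ (m - 1) * s := by
      rw [← pow_succ, Nat.sub_add_cancel hm]
    rw [hsm]; push_cast; field_simp; ring

/-- `s^m P_{m,k}(s) → 0` as `s → 0⁺` for `m ≥ 1`. [folklore] -/
theorem tendsto_pow_mul_pfun {m : ℕ} (hm : 1 ≤ m) (k : ℕ) :
    Tendsto (fun s : ℝ => s ^ m * Pfun m k s) (𝓝[>] 0) (𝓝 0) := by
  have h := (tendsto_pow_log_mul_self 1 k).const_mul (∑ j ∈ range (k + 1), |pcoef m k j|)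
  rw [mul_zero] at h
  refine squeeze_zero_norm' ?_ h
  filter_upwards [Ioo_mem_nhdsGT (zero_lt_one' ℝ)] with s hs
  rw [Real.norm_eq_abs, abs_mul, abs_pow, abs_of_pos hs.1]
  have h1 := abs_pfun_le m le_rfl s (k := k)
  calc s ^ m * |Pfun m k s| ≤ s * ((∑ j ∈ range (k + 1), |pcoef m k j|) * (1 + |Real.log s|) ^ k) :=
        mul_le_mul (by simpa using pow_le_pow_of_le_one hs.1.le hs.2.le hm) h1 (abs_nonneg _) hs.1.le
    _ = (∑ j ∈ range (k + 1), |pcoef m k j|) * ((|Real.log s| + 1) ^ k * s) := by ring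

/-- The divergent part `D(s) = Σ_k c_{0,k} log^{k+1} s/(k+1)` and its derivative. [folklore] -/
theorem hasDerivAt_logDiv (c : ℕ → ℕ → ℝ) (n : ℕ) {s : ℝ} (hs : 0 < s) :
    HasDerivAt (fun s => ∑ k ∈ range (n + 1), c 0 k * (Real.log s ^ (k + 1) / (k + 1)))
      (∑ k ∈ range (n + 1), c 0 k * (Real.log s ^ k * s⁻¹)) s := by
  have h := HasDerivAt.sum (u := range (n + 1))
    (A := fun k s => c 0 k * (Real.log s ^ (k + 1) / (k + 1)))
    (A' := fun k => c 0 k * (Real.log s ^ k * s⁻¹)) (x := s) fun k _ => ?_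
  · have hf : (fun s => ∑ k ∈ range (n + 1), c 0 k * (Real.log s ^ (k + 1) / (k + 1))) =
        ∑ k ∈ range (n + 1), fun s => c 0 k * (Real.log s ^ (k + 1) / (k + 1)) := by
      funext x; rw [Finset.sum_apply]
    rw [hf]; exact h
  · have hlog : HasDerivAt (fun x => Real.log x ^ (k + 1)) (((k + 1 : ℕ) : ℝ) * Real.log s ^ k * s⁻¹) s := by
      have h := (hasDerivAt_pow (k + 1) (Real.log s)).comp s (Real.hasDerivAt_log hs.ne')
      refine h.congr_deriv ?_
      rw [Nat.add_sub_cancel]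
    refine ((hlog.div_const ((k : ℝ) + 1)).const_mul (c 0 k)).congr_deriv ?_
    push_cast; field_simp

/-- **The coefficients of the primitive**: constant term `c₀`, divergent logarithms
`c_{0,k-1}/k · log^k`, and for `m ≥ 1` the coefficients of `Σ_{k'} c_{m,k'} s^m P_{m,k'}`. [folklore] -/
def primCoeff (c : ℕ → ℕ → ℝ) (n : ℕ) (c₀ : ℝ) (m k : ℕ) : ℝ :=
  if m = 0 then (if k = 0 then c₀ else c 0 (k - 1) / k)
  else ∑ k' ∈ range (n + 1), c m k' * pcoef m k' k

/-- The `m ≥ 1` part of the expansion of the primitive equals `Σ_{k'} c_{m,k'} s^m P_{m,k'}(s)`.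
[folklore] -/
theorem sum_primCoeff_succ (c : ℕ → ℕ → ℝ) (n : ℕ) (c₀ : ℝ) {m : ℕ} (hm : m ≠ 0) (s : ℝ) :
    ∑ k ∈ range (n + 2), primCoeff c n c₀ m k * (s ^ m * Real.log s ^ k) =
      ∑ k' ∈ range (n + 1), c m k' * (s ^ m * Pfun m k' s) := by
  simp only [primCoeff, hm, if_false, Finset.sum_mul]
  rw [Finset.sum_comm]
  refine Finset.sum_congr rfl fun k' hk' => ?_
  rw [pfun_eq_sum m k' (K := n + 2) (by have := mem_range.mp hk'; omega) s, Finset.mul_sum, Finset.mul_sum]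
  refine Finset.sum_congr rfl fun k _ => ?_
  ring

/-- The `m = 0` part of the expansion of the primitive is `c₀ + D(s)`. [folklore] -/
theorem sum_primCoeff_zero (c : ℕ → ℕ → ℝ) (n : ℕ) (c₀ : ℝ) (s : ℝ) :
    ∑ k ∈ range (n + 2), primCoeff c n c₀ 0 k * (s ^ 0 * Real.log s ^ k) =
      c₀ + ∑ k ∈ range (n + 1), c 0 k * (Real.log s ^ (k + 1) / (k + 1)) := by
  rw [Finset.sum_range_succ']
  simp only [primCoeff, if_true, Nat.succ_ne_zero, if_false, Nat.add_sub_cancel, pow_zero, one_mul, mul_one]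
  rw [add_comm]
  congr 1
  refine Finset.sum_congr rfl fun k _ => ?_
  push_cast; ring

/-- **Closure of logarithmic Taylor expansions under primitives.** If `h` has a logarithmic
Taylor expansion of log-degree `n` and `φ' = h/s` on `(0,δ)`, then `φ` has a logarithmic Taylor
expansion of log-degree `n + 1`, with coefficients `primCoeff c n c₀` for a (unique) constant `c₀`,
the REGULARISED VALUE of `φ` at `0⁺`. [folklore] -/
theorem hasLogTaylor_of_hasDerivAt {φ h : ℝ → ℝ} {c : ℕ → ℕ → ℝ} {n : ℕ} {δ : ℝ}
    (hh : HasLogTaylor h c n) (hδ : 0 < δ) (hd : ∀ s ∈ Set.Ioo 0 δ, HasDerivAt φ (h s / s) s) :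
    ∃ c₀ : ℝ, HasLogTaylor φ (primCoeff c n c₀) (n + 1) := by
  have hcv := hh.1
  -- uniform control on an interval `(0, δ₁)`
  have hsmall : ∀ᶠ s in 𝓝[>] (0 : ℝ), s * (1 + |Real.log s|) ^ n ≤ 1 := by
    have h := tendsto_pow_log_mul_self 1 n
    have h1 : ∀ᶠ s in 𝓝[>] (0 : ℝ), (|Real.log s| + 1) ^ n * s < 1 := h (Iio_mem_nhds zero_lt_one)
    filter_upwards [h1] with s hs
    linarith [show s * (1 + |Real.log s|) ^ n = (|Real.log s| + 1) ^ n * s by ring]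
  -- the derivative of the truncated primitive
  set D : ℝ → ℝ := fun s => ∑ k ∈ range (n + 1), c 0 k * (Real.log s ^ (k + 1) / (k + 1)) with hD
  set E : ℕ → ℝ → ℝ := fun m s => ∑ k' ∈ range (n + 1), c m k' * (s ^ m * Pfun m k' s) with hE
  have hEd : ∀ {m : ℕ}, 1 ≤ m → ∀ {s : ℝ}, 0 < s →
      HasDerivAt (E m) (∑ k' ∈ range (n + 1), c m k' * (s ^ (m - 1) * Real.log s ^ k')) s := by
    intro m hm s hs
    have h := HasDerivAt.sum (u := range (n + 1)) (A := fun k' s => c m k' * (s ^ m * Pfun m k' s))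
      (A' := fun k' => c m k' * (s ^ (m - 1) * Real.log s ^ k')) (x := s)
      fun k' _ => (hasDerivAt_pow_mul_pfun hm k' hs).const_mul _
    have hf : E m = ∑ k' ∈ range (n + 1), fun s => c m k' * (s ^ m * Pfun m k' s) := by
      funext x; rw [hE, Finset.sum_apply]
    rw [hf]; exact h
  -- `T_N h(s)/s = D'(s) + Σ_{1 ≤ m ≤ N} E_m'(s)`
  have hTdiv : ∀ (N : ℕ) {s : ℝ}, 0 < s → logTaylorSum c n N s / s =
      (∑ k ∈ range (n + 1), c 0 k * (Real.log s ^ k * s⁻¹)) +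
        ∑ m ∈ Finset.Ico 1 (N + 1), ∑ k' ∈ range (n + 1), c m k' * (s ^ (m - 1) * Real.log s ^ k') := by
    intro N s hs
    unfold logTaylorSum
    rw [← Finset.sum_range_add_sum_Ico _ (Nat.succ_le_succ (Nat.zero_le N)), Finset.sum_range_one, add_div,
      Finset.sum_div, Finset.sum_div]
    congr 1
    · refine Finset.sum_congr rfl fun k _ => ?_
      rw [pow_zero, one_mul]; field_simp
    · refine Finset.sum_congr rfl fun m hm => ?_
      rw [Finset.mem_Ico] at hm
      rw [Finset.sum_div]
      refine Finset.sum_congr rfl fun k' _ => ?_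
      have hsm : s ^ m = s ^ (m - 1) * s := by rw [← pow_succ, Nat.sub_add_cancel hm.1]
      rw [hsm]; field_simp
  -- Step 1: `ψ = φ - D - E 1` has bounded derivative, hence a limit `c₀`
  obtain ⟨C₁, hC₁⟩ := hh.2 1
  obtain ⟨δ₁, hδ₁, hsub₁⟩ : ∃ δ₁ > 0, Set.Ioo 0 δ₁ ⊆ {s | |h s - logTaylorSum c n 1 s| ≤ C₁ * (s ^ 2 * (1 + |Real.log s|) ^ n)
      ∧ s * (1 + |Real.log s|) ^ n ≤ 1 ∧ s ∈ Set.Ioo (0 : ℝ) δ} :=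
    mem_nhdsGT_iff_exists_Ioo_subset.mp (hC₁.and (hsmall.and (Ioo_mem_nhdsGT hδ)))
  set ψ : ℝ → ℝ := fun s => φ s - D s - E 1 s with hψ
  have hψd : ∀ s ∈ Set.Ioo 0 δ₁, HasDerivAt ψ ((h s - logTaylorSum c n 1 s) / s) s := by
    intro s hs
    obtain ⟨-, -, hsδ⟩ := hsub₁ hs
    have h1 := ((hd s hsδ).sub (hasDerivAt_logDiv c n hs.1)).sub (hEd le_rfl hs.1)
    refine h1.congr_deriv ?_
    rw [sub_div, hTdiv 1 hs.1]
    simp only [Nat.sub_self, pow_zero, one_mul, Finset.sum_Ico_succ_top (le_refl 1), Finset.Ico_self,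
      Finset.sum_empty, zero_add]
    ring
  obtain ⟨c₀, hc₀⟩ : ∃ ℓ, Tendsto ψ (𝓝[>] 0) (𝓝 ℓ) := by
    refine exists_tendsto_of_deriv_bound hδ₁ hψd (K := |C₁|) fun s hs => ?_
    obtain ⟨h1, h2, -⟩ := hsub₁ hs
    rw [abs_div, abs_of_pos hs.1, div_le_iff₀ hs.1]
    refine h1.trans ?_
    calc C₁ * (s ^ 2 * (1 + |Real.log s|) ^ n) ≤ |C₁| * (s ^ 2 * (1 + |Real.log s|) ^ n) :=
          mul_le_mul_of_nonneg_right (le_abs_self _) (by have := hs.1.le; positivity)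
      _ = |C₁| * s * (s * (1 + |Real.log s|) ^ n) := by ring
      _ ≤ |C₁| * s * 1 := mul_le_mul_of_nonneg_left h2 (by have := hs.1.le; positivity)
      _ = |C₁| * s := mul_one _
  refine ⟨c₀, fun m k hk => ?_, fun M => ?_⟩
  · -- vanishing of the coefficients above log-degree `n + 1`
    unfold primCoeff
    split_ifs with hm hk0
    · omega
    · rw [hcv 0 (k - 1) (by omega), zero_div]
    · exact Finset.sum_eq_zero fun k' hk' => by
        rw [pcoef_eq_zero m (by have := mem_range.mp hk'; omega), mul_zero]
  -- Step 2: the remainder `R = φ - c₀ - D - Σ_{m=1}^{M+1} E_m` is `O(s^{M+1})`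
  obtain ⟨C, hC⟩ := hh.2 (M + 1)
  obtain ⟨δ₂, hδ₂, hsub₂⟩ : ∃ δ₂ > 0, Set.Ioo 0 δ₂ ⊆ {s | |h s - logTaylorSum c n (M + 1) s| ≤
      C * (s ^ (M + 2) * (1 + |Real.log s|) ^ n) ∧ s ∈ Set.Ioo (0 : ℝ) δ₁} :=
    mem_nhdsGT_iff_exists_Ioo_subset.mp (hC.and (Ioo_mem_nhdsGT hδ₁))
  set R : ℝ → ℝ := fun s => φ s - c₀ - D s - ∑ m ∈ Finset.Ico 1 (M + 2), E m s with hR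
  have hRd : ∀ s ∈ Set.Ioo 0 δ₂, HasDerivAt R ((h s - logTaylorSum c n (M + 1) s) / s) s := by
    intro s hs
    obtain ⟨-, hs₁⟩ := hsub₂ hs
    obtain ⟨-, -, hsδ⟩ := hsub₁ hs₁
    have hsum := HasDerivAt.sum (u := Finset.Ico 1 (M + 2)) (A := fun m s => E m s)
      (A' := fun m => ∑ k' ∈ range (n + 1), c m k' * (s ^ (m - 1) * Real.log s ^ k')) (x := s)
      fun m hm => hEd (Finset.mem_Ico.mp hm).1 hs.1
    have hf : (fun s => ∑ m ∈ Finset.Ico 1 (M + 2), E m s) = ∑ m ∈ Finset.Ico 1 (M + 2), fun s => E m s := by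
      funext x; rw [Finset.sum_apply]
    rw [← hf] at hsum
    have h1 := (((hd s hsδ).sub (hasDerivAt_const s c₀)).sub (hasDerivAt_logDiv c n hs.1)).sub hsum
    refine h1.congr_deriv ?_
    rw [sub_div, hTdiv (M + 1) hs.1]
    ring
  have hR0 : Tendsto R (𝓝[>] 0) (𝓝 0) := by
    -- `R = ψ - c₀ - Σ_{m=2}^{M+1} E_m`, `ψ → c₀`, `E_m → 0`
    have hE0 : ∀ m ∈ Finset.Ico 2 (M + 2), Tendsto (E m) (𝓝[>] 0) (𝓝 0) := by
      intro m hm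
      have hm1 : 1 ≤ m := by have := (Finset.mem_Ico.mp hm).1; omega
      have h := tendsto_finsetSum (range (n + 1)) (f := fun k' s => c m k' * (s ^ m * Pfun m k' s))
        (a := fun _ => (0 : ℝ)) (x := 𝓝[>] (0 : ℝ)) fun k' _ => by
          simpa using (tendsto_pow_mul_pfun hm1 k').const_mul (c m k')
      simp only [Finset.sum_const_zero] at h
      refine h.congr fun s => ?_
      rw [hE]
    have hsum := tendsto_finsetSum (Finset.Ico 2 (M + 2)) hE0
    simp only [Finset.sum_const_zero] at hsum
    have htot := (hc₀.sub (tendsto_const_nhds (x := c₀))).sub hsum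
    rw [sub_self, sub_zero] at htot
    refine htot.congr fun s => ?_
    have hsplit : ∑ m ∈ Finset.Ico 1 (M + 2), E m s = E 1 s + ∑ m ∈ Finset.Ico 2 (M + 2), E m s := by
      rw [Finset.sum_eq_sum_Ico_succ_bot (by omega : 1 < M + 2)]
    simp only [hR, hψ, hsplit]
    ring
  have hRb : ∀ s ∈ Set.Ioo 0 δ₂, |R s| ≤ |C| * s ^ (M + 1) / (M + 1) := by
    refine abs_le_of_deriv_bound_of_tendsto_zero hRd (fun s hs => ?_) hR0
    obtain ⟨h1, hs₁⟩ := hsub₂ hs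
    obtain ⟨-, h2, -⟩ := hsub₁ hs₁
    rw [abs_div, abs_of_pos hs.1, div_le_iff₀ hs.1]
    refine h1.trans ?_
    have hs0 := hs.1.le
    calc C * (s ^ (M + 2) * (1 + |Real.log s|) ^ n) ≤ |C| * (s ^ (M + 2) * (1 + |Real.log s|) ^ n) :=
          mul_le_mul_of_nonneg_right (le_abs_self _) (by positivity)
      _ = |C| * s ^ M * s * (s * (1 + |Real.log s|) ^ n) := by ring
      _ ≤ |C| * s ^ M * s * 1 := mul_le_mul_of_nonneg_left h2 (by positivity)
      _ = |C| * s ^ M * s := mul_one _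
  -- Step 3: conclusion at order `M`
  set A : ℝ := ∑ k' ∈ range (n + 1), |c (M + 1) k'| * ∑ j ∈ range (k' + 1), |pcoef (M + 1) k' j| with hA
  refine ⟨|C| / (M + 1) + A, ?_⟩
  filter_upwards [mem_nhdsGT_iff_exists_Ioo_subset.mpr ⟨δ₂, hδ₂, subset_rfl⟩,
    Ioo_mem_nhdsGT (zero_lt_one' ℝ)] with s hs hs1
  have hs0 := hs.1.le
  set Λ := 1 + |Real.log s| with hΛ
  have hΛ1 : 1 ≤ Λ := one_le_lam s
  -- identify the truncated expansion
  have hexp : logTaylorSum (primCoeff c n c₀) (n + 1) M s = c₀ + D s + ∑ m ∈ Finset.Ico 1 (M + 1), E m s := by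
    unfold logTaylorSum
    rw [← Finset.sum_range_add_sum_Ico _ (Nat.succ_le_succ (Nat.zero_le M)), Finset.sum_range_one,
      sum_primCoeff_zero c n c₀ s]
    congr 1
    refine Finset.sum_congr rfl fun m hm => ?_
    rw [sum_primCoeff_succ c n c₀ (by have := (Finset.mem_Ico.mp hm).1; omega) s]
  have hdec : φ s - logTaylorSum (primCoeff c n c₀) (n + 1) M s = R s + E (M + 1) s := by
    rw [hexp, hR]
    simp only
    rw [Finset.sum_Ico_succ_top (by omega : 1 ≤ M + 1)]
    ring
  have hEb : |E (M + 1) s| ≤ A * (s ^ (M + 1) * Λ ^ (n + 1)) := by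
    rw [hE, hA, Finset.sum_mul]
    refine (Finset.abs_sum_le_sum_abs _ _).trans (Finset.sum_le_sum fun k' hk' => ?_)
    have hk'n : k' ≤ n := Nat.lt_succ_iff.mp (mem_range.mp hk')
    rw [abs_mul, abs_mul, abs_pow, abs_of_pos hs.1]
    calc |c (M + 1) k'| * (s ^ (M + 1) * |Pfun (M + 1) k' s|)
        ≤ |c (M + 1) k'| * (s ^ (M + 1) * ((∑ j ∈ range (k' + 1), |pcoef (M + 1) k' j|) * Λ ^ (n + 1))) :=
          mul_le_mul_of_nonneg_left (mul_le_mul_of_nonneg_left (abs_pfun_le (M + 1) (hk'n.trans (Nat.le_succ n)) s)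
            (pow_nonneg hs0 _)) (abs_nonneg _)
      _ = |c (M + 1) k'| * (∑ j ∈ range (k' + 1), |pcoef (M + 1) k' j|) * (s ^ (M + 1) * Λ ^ (n + 1)) := by ring
  rw [hdec]
  calc |R s + E (M + 1) s| ≤ |R s| + |E (M + 1) s| := abs_add_le _ _
    _ ≤ |C| * s ^ (M + 1) / (M + 1) + A * (s ^ (M + 1) * Λ ^ (n + 1)) := add_le_add (hRb s hs) hEb
    _ ≤ |C| / (M + 1) * (s ^ (M + 1) * Λ ^ (n + 1)) + A * (s ^ (M + 1) * Λ ^ (n + 1)) := by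
        refine add_le_add ?_ le_rfl
        calc |C| * s ^ (M + 1) / (M + 1) = |C| / (M + 1) * (s ^ (M + 1) * 1) := by ring
          _ ≤ |C| / (M + 1) * (s ^ (M + 1) * Λ ^ (n + 1)) :=
              mul_le_mul_of_nonneg_left (mul_le_mul_of_nonneg_left (one_le_pow₀ hΛ1) (pow_nonneg hs0 _))
                (by positivity)
    _ = (|C| / (M + 1) + A) * (s ^ (M + 1) * Λ ^ (n + 1)) := by ring

end Primitive

/-! ### Regularised values from logarithmic Taylor expansions -/

section RegValueLog

/-- `s^d (1 + |log s|)^n → 0` as `s → 0⁺` for `d ≥ 1`. [folklore] -/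
theorem tendsto_zpow_mul_lam_pow {d : ℤ} (hd : 1 ≤ d) (n : ℕ) :
    Tendsto (fun s : ℝ => s ^ d * (1 + |Real.log s|) ^ n) (𝓝[>] 0) (𝓝 0) := by
  have h := tendsto_pow_log_mul_self 1 n
  obtain ⟨e, he⟩ := Int.eq_ofNat_of_zero_le (by omega : 0 ≤ d - 1)
  have hd' : d = ((e + 1 : ℕ) : ℤ) := by push_cast; omega
  refine squeeze_zero_norm' ?_ h
  filter_upwards [Ioo_mem_nhdsGT (zero_lt_one' ℝ)] with s hs
  have hΛ : 0 ≤ (1 + |Real.log s|) ^ n := pow_nonneg (by linarith [abs_nonneg (Real.log s)]) _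
  rw [Real.norm_eq_abs, abs_mul, abs_of_nonneg (zpow_nonneg hs.1.le _), abs_of_nonneg hΛ, hd', zpow_natCast,
    pow_succ, add_comm (1 : ℝ)]
  calc s ^ e * s * (|Real.log s| + 1) ^ n ≤ 1 * s * (|Real.log s| + 1) ^ n := by
        refine mul_le_mul_of_nonneg_right (mul_le_mul_of_nonneg_right (pow_le_one₀ hs.1.le hs.2.le) hs.1.le) ?_
        rw [add_comm]; exact hΛ
    _ = (|Real.log s| + 1) ^ n * s := by ring

/-- A single monomial `r · s^{m+j} log^k s` has regularised value `r` if `m + j = 0 = k`, else `0`.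
[folklore] -/
theorem hasRegValue_monomial (r : ℝ) (m : ℕ) (j : ℤ) (k : ℕ) :
    HasRegValue (fun s : ℝ => r * (s ^ ((m : ℤ) + j) * Real.log s ^ k))
      (if k = 0 ∧ (m : ℤ) + j = 0 then r else 0) := by
  by_cases h0 : (m : ℤ) + j = 0
  · by_cases hk : k = 0
    · simp only [hk, h0, and_self, if_true]
      refine hasRegValue_of_tendsto ((tendsto_const_nhds (x := r)).congr' ?_)
      filter_upwards [self_mem_nhdsWithin] with s (hs : 0 < s)
      simp
    · simp only [hk, false_and, if_false]
      exact hasRegValue_singular (p := ((m : ℤ) + j, k)) (Or.inr ⟨h0, Nat.pos_of_ne_zero hk⟩) r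
  · simp only [h0, and_false, if_false]
    rcases lt_or_gt_of_ne h0 with hneg | hpos
    · exact hasRegValue_singular (p := ((m : ℤ) + j, k)) (Or.inl hneg) r
    · refine hasRegValue_of_tendsto ?_
      have h := (tendsto_zpow_mul_abs_log_pow (d := (m : ℤ) + j) (by omega) k).const_mul (|r|)
      rw [mul_zero] at h
      refine squeeze_zero_norm' ?_ h
      filter_upwards [self_mem_nhdsWithin] with s hs
      have hs0 : 0 < s := hs
      rw [Real.norm_eq_abs, abs_mul, abs_mul, abs_pow, abs_zpow, abs_of_pos hs0]

/-- **Regularised value of `s^j φ(s)`** for `φ` with a logarithmic Taylor expansion: the constant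
coefficient `c_{-j,0}` (`0` if `j > 0`). [folklore] -/
theorem HasLogTaylor.hasRegValue_zpow_mul {φ : ℝ → ℝ} {c : ℕ → ℕ → ℝ} {n : ℕ}
    (h : HasLogTaylor φ c n) (j : ℤ) :
    HasRegValue (fun s => s ^ j * φ s) (if j ≤ 0 then c (-j).toNat 0 else 0) := by
  classical
  set M : ℕ := (-j).toNat with hM
  have hMj : 1 ≤ (M : ℤ) + 1 + j := by rw [hM]; omega
  obtain ⟨C, hC⟩ := h.2 M
  -- the monomials
  have hmono : ∀ m ∈ Finset.range (M + 1), HasRegValue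
      (fun s : ℝ => ∑ k ∈ Finset.range (n + 1), c m k * (s ^ ((m : ℤ) + j) * Real.log s ^ k))
      (∑ k ∈ Finset.range (n + 1), if k = 0 ∧ (m : ℤ) + j = 0 then c m k else 0) :=
    fun m _ => HasRegValue.sum (Finset.range (n + 1)) fun k _ => hasRegValue_monomial (c m k) m j k
  have hsum := HasRegValue.sum (Finset.range (M + 1)) hmono
  -- the remainder
  have hrem : HasRegValue (fun s : ℝ => s ^ j * (φ s - logTaylorSum c n M s)) 0 := by
    refine hasRegValue_of_tendsto ?_
    have h1 := (tendsto_zpow_mul_lam_pow hMj n).const_mul (|C|)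
    rw [mul_zero] at h1
    refine squeeze_zero_norm' ?_ h1
    filter_upwards [hC, self_mem_nhdsWithin] with s hs hs0'
    have hs0 : 0 < s := hs0'
    rw [Real.norm_eq_abs, abs_mul, abs_zpow, abs_of_pos hs0]
    have hzp : s ^ ((M : ℤ) + 1 + j) = s ^ (M + 1) * s ^ j := by
      rw [zpow_add₀ hs0.ne', ← zpow_natCast]; push_cast; ring
    calc s ^ j * |φ s - logTaylorSum c n M s| ≤ s ^ j * (|C| * (s ^ (M + 1) * (1 + |Real.log s|) ^ n)) := by
          refine mul_le_mul_of_nonneg_left (hs.trans ?_) (zpow_nonneg hs0.le _)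
          exact mul_le_mul_of_nonneg_right (le_abs_self C) (by positivity)
      _ = |C| * (s ^ ((M : ℤ) + 1 + j) * (1 + |Real.log s|) ^ n) := by rw [hzp]; ring
  have htot := hsum.add hrem
  have hval : (∑ m ∈ Finset.range (M + 1), ∑ k ∈ Finset.range (n + 1),
      if k = 0 ∧ (m : ℤ) + j = 0 then c m k else 0) + 0 = if j ≤ 0 then c (-j).toNat 0 else 0 := by
    rw [add_zero]
    have hinner : ∀ m : ℕ, (∑ k ∈ Finset.range (n + 1), if k = 0 ∧ (m : ℤ) + j = 0 then c m k else 0) =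
        if (m : ℤ) + j = 0 then c m 0 else 0 := by
      intro m
      rw [Finset.sum_eq_single_of_mem 0 (by simp) (fun k _ hk => if_neg fun h => hk h.1)]
      by_cases hm : (m : ℤ) + j = 0
      · rw [if_pos ⟨rfl, hm⟩, if_pos hm]
      · rw [if_neg (fun h => hm h.2), if_neg hm]
    simp_rw [hinner]
    by_cases hj : j ≤ 0
    · rw [if_pos hj, Finset.sum_eq_single_of_mem M (by simp) (fun m _ hm => if_neg fun h => hm ?_)]
      · rw [if_pos (by rw [hM]; omega)]
      · rw [hM]; omega
    · rw [if_neg hj]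
      exact Finset.sum_eq_zero fun m _ => if_neg fun h => hj (by omega)
  rw [← hval]
  refine htot.congr ?_
  filter_upwards [self_mem_nhdsWithin] with s hs
  have hs0 : 0 < s := hs
  have hT : ∑ m ∈ Finset.range (M + 1), ∑ k ∈ Finset.range (n + 1), c m k * (s ^ ((m : ℤ) + j) * Real.log s ^ k) =
      s ^ j * logTaylorSum c n M s := by
    unfold logTaylorSum
    rw [Finset.mul_sum]
    refine Finset.sum_congr rfl fun m _ => ?_
    rw [Finset.mul_sum]
    refine Finset.sum_congr rfl fun k _ => ?_
    rw [zpow_add₀ hs0.ne', zpow_natCast]; ring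
  show (∑ m ∈ Finset.range (M + 1), ∑ k ∈ Finset.range (n + 1), c m k * (s ^ ((m : ℤ) + j) * Real.log s ^ k)) +
      s ^ j * (φ s - logTaylorSum c n M s) = s ^ j * φ s
  rw [hT]; ring

end RegValueLog

end Hyperlog

end Literature.NumberTheory.Transcendental
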